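import Summits.NavierStokesRegularity.JiaSverakCAP.Det2pdChain
import HarnessLib

/-!
# Lemmas for the DET-2pd kernel certificates (`JiaSverakCAP.Det2pdKernelCert`, generic part)

HONEST FRAMING (papers lane (c), PF-P2 writer seat papers-pfp2-w1 g3, for the audit cell `pub-nsjs`). Finite-dimensional real
linear algebra and `ℚ → ℝ` transport only; asserts nothing about Navier–Stokes. These are the generic steps that turn the
kernel-evaluated rational facts of the data modules `Det2pdKernelCertZm` / `Det2pdKernelCertZp` into the hypotheses of
`Det2pdChain`: (i) `Σᵢⱼ (1 − P M)ᵢⱼ² < 1 ⇒ 0 < det (P M)` (operator norm ≤ Frobenius norm, the non-singular segment from `1` to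
`P M`, `PreconditionedDetSign.det_sign_of_segment`); (ii) with `P = Ui Li`, `Ui` upper and `Li` unit lower triangular, the sign
of `det Mt` is the sign of `∏ (Ui)ᵢᵢ`; (iii) `Bᵀ = B`, `‖B − c 1‖_F < c` ⇒ `B ≻ 0`, hence `A = B + Rᵀ R ≻ 0`; (iv) the cast
bookkeeping `ℚ → ℝ` for Frobenius sums, `1 − P Mt`, determinants and the residual `Mtᵀ Mt − η² 1 − Rᵀ R − μ 1`; (v) the test-#1
arithmetic `θ + π η < 1` from `πsq η² < (1 − θ)²`. Reference for the two non-singularity tests: S. M. Rump, *Verification methods*,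
Acta Numerica 19 (2010) §10 [Rump2010Verification]; proofs from first principles [folklore].
-/

open scoped BigOperators Matrix Matrix.Norms.L2Operator
open Set

noncomputable section

namespace Summit.NavierStokesRegularity.JiaSverakCAP

namespace Det2pdKernelCert

open PreconditionedDetSign Det2pdChain

section Real

variable {ι : Type*} [Fintype ι] [DecidableEq ι]

/-- `Σᵢⱼ (1 − P M)ᵢⱼ² < 1` forces `0 < det (P M)`: the operator norm is at most the Frobenius norm, so every matrix on the
segment from `1` to `P M` is within operator-norm distance `< 1` of `1`, hence non-singular, and `det 1 = 1 > 0`. [folklore] -/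
theorem det_mul_pos_of_frobenius_lt_one (P M : Matrix ι ι ℝ)
    (h : ∑ i, ∑ j, ((1 : Matrix ι ι ℝ) - P * M) i j ^ 2 < 1) : 0 < (P * M).det := by
  have hnorm : ‖(1 : Matrix ι ι ℝ) - P * M‖ < 1 := by
    refine lt_of_le_of_lt (l2_opNorm_le_sqrt_sum_sq _) ?_
    calc Real.sqrt (∑ i, ∑ j, ((1 : Matrix ι ι ℝ) - P * M) i j ^ 2) < Real.sqrt 1 :=
          Real.sqrt_lt_sqrt (Finset.sum_nonneg fun i _ => Finset.sum_nonneg fun j _ => sq_nonneg _) h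
      _ = 1 := Real.sqrt_one
  have hseg : ∀ t ∈ Icc (0 : ℝ) 1, ((1 : Matrix ι ι ℝ) + t • (P * M - 1)).det ≠ 0 := by
    intro t ht
    apply det_ne_zero_of_norm_one_sub_lt
    have hrw : (1 : Matrix ι ι ℝ) - (1 + t • (P * M - 1)) = t • ((1 : Matrix ι ι ℝ) - P * M) := by
      rw [smul_sub, smul_sub]; abel
    rw [hrw, norm_smul, Real.norm_of_nonneg ht.1]
    calc t * ‖(1 : Matrix ι ι ℝ) - P * M‖ ≤ 1 * ‖(1 : Matrix ι ι ℝ) - P * M‖ :=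
          mul_le_mul_of_nonneg_right ht.2 (norm_nonneg _)
      _ < 1 := by rw [one_mul]; exact hnorm
  obtain ⟨-, -, hiff, -⟩ := det_sign_of_segment (1 : Matrix ι ι ℝ) (P * M) hseg
  exact hiff.mp (by rw [Matrix.det_one]; exact one_pos)

/-- A Frobenius bound is an operator-norm bound: `Σᵢⱼ Aᵢⱼ² ≤ c²`, `0 ≤ c` ⇒ `‖A‖₂ ≤ c`. [folklore] -/
theorem norm_le_of_frobenius_le (A : Matrix ι ι ℝ) {c : ℝ} (hc : 0 ≤ c) (h : ∑ i, ∑ j, A i j ^ 2 ≤ c ^ 2) :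
    ‖A‖ ≤ c :=
  (l2_opNorm_le_sqrt_sum_sq A).trans ((Real.sqrt_le_sqrt h).trans_eq (Real.sqrt_sq hc))

/-- **Positive definiteness from a Frobenius ball around a multiple of the identity.** If `Bᵀ = B`, `0 < c` and
`Σᵢⱼ (B − c 1)ᵢⱼ² < c²` then `B ≻ 0`: `xᵀ B x = c |x|² + xᵀ (B − c 1) x ≥ (c − ‖B − c 1‖₂) |x|² > 0`. [folklore] -/
theorem posDef_of_frobenius_sub_smul_one_lt (B : Matrix ι ι ℝ) (hsym : Bᵀ = B) {c : ℝ} (hc : 0 < c)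
    (h : ∑ i, ∑ j, (B - c • (1 : Matrix ι ι ℝ)) i j ^ 2 < c ^ 2) : B.PosDef := by
  set E : Matrix ι ι ℝ := B - c • (1 : Matrix ι ι ℝ) with hE
  have hEn : ‖E‖ < c := by
    refine lt_of_le_of_lt (l2_opNorm_le_sqrt_sum_sq E) ?_
    calc Real.sqrt (∑ i, ∑ j, E i j ^ 2) < Real.sqrt (c ^ 2) :=
          Real.sqrt_lt_sqrt (Finset.sum_nonneg fun i _ => Finset.sum_nonneg fun j _ => sq_nonneg _) h
      _ = c := Real.sqrt_sq hc.le
  have hherm : B.IsHermitian := by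
    unfold Matrix.IsHermitian
    rw [Matrix.conjTranspose_eq_transpose_of_trivial, hsym]
  refine Matrix.PosDef.of_dotProduct_mulVec_pos hherm fun x hx => ?_
  rw [star_trivial]
  have hB : B = c • (1 : Matrix ι ι ℝ) + E := by rw [hE]; abel
  have hsplit : x ⬝ᵥ (B *ᵥ x) = c * (x ⬝ᵥ x) + x ⬝ᵥ (E *ᵥ x) := by
    rw [hB, Matrix.add_mulVec, dotProduct_add, Matrix.smul_mulVec, Matrix.one_mulVec, dotProduct_smul,
      smul_eq_mul]
  set y : EuclideanSpace ℝ ι := (EuclideanSpace.equiv ι ℝ).symm x with hy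
  have hxx : x ⬝ᵥ x = ‖y‖ ^ 2 := (norm_sq_eq_dotProduct x).symm
  have hy0 : y ≠ 0 := by
    intro h0
    apply hx
    have : (⇑y : ι → ℝ) = x := rfl
    rw [← this, h0]
    rfl
  have hypos : 0 < ‖y‖ := norm_pos_iff.mpr hy0
  have hcs : (x ⬝ᵥ (E *ᵥ x)) ^ 2 ≤ (x ⬝ᵥ x) * ((E *ᵥ x) ⬝ᵥ (E *ᵥ x)) := by
    have := Finset.sum_mul_sq_le_sq_mul_sq Finset.univ x (E *ᵥ x)
    simpa only [dotProduct, pow_two] using this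
  have hEx : (E *ᵥ x) ⬝ᵥ (E *ᵥ x) ≤ (‖E‖ * ‖y‖) ^ 2 := by
    rw [← norm_sq_eq_dotProduct]
    exact pow_le_pow_left₀ (norm_nonneg _) (norm_mulVec_le E x) 2
  have habs : |x ⬝ᵥ (E *ᵥ x)| ≤ ‖E‖ * ‖y‖ ^ 2 := by
    refine abs_le_of_sq_le_sq ?_ (by positivity)
    calc (x ⬝ᵥ (E *ᵥ x)) ^ 2 ≤ (x ⬝ᵥ x) * ((E *ᵥ x) ⬝ᵥ (E *ᵥ x)) := hcs
      _ ≤ ‖y‖ ^ 2 * (‖E‖ * ‖y‖) ^ 2 := by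
          rw [hxx]; exact mul_le_mul_of_nonneg_left hEx (sq_nonneg _)
      _ = (‖E‖ * ‖y‖ ^ 2) ^ 2 := by ring
  rw [hsplit, hxx]
  have hlow := (abs_le.mp habs).1
  nlinarith [mul_pos (sub_pos.mpr hEn) (pow_pos hypos 2)]

/-- `B ≻ 0` (Frobenius-ball certificate) and `A = B + Rᵀ R` give `A ≻ 0`. [folklore] -/
theorem posDef_of_residual (A R : Matrix ι ι ℝ) {c : ℝ} (hc : 0 < c) (hsym : (A - Rᵀ * R)ᵀ = A - Rᵀ * R)
    (h : ∑ i, ∑ j, ((A - Rᵀ * R) - c • (1 : Matrix ι ι ℝ)) i j ^ 2 < c ^ 2) : A.PosDef := by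
  have hB := posDef_of_frobenius_sub_smul_one_lt (A - Rᵀ * R) hsym hc h
  have hR : (Rᵀ * R).PosSemidef := by
    have := Matrix.posSemidef_conjTranspose_mul_self R
    rwa [Matrix.conjTranspose_eq_transpose_of_trivial] at this
  have := hB.add_posSemidef hR
  rwa [sub_add_cancel] at this

end Real

section Triangular

variable {n : ℕ} {K : Type*} [CommRing K]

/-- Determinant of an upper triangular matrix on `Fin n`. [folklore] -/
theorem det_eq_prod_diag_of_upper (U : Matrix (Fin n) (Fin n) K) (h : ∀ i j : Fin n, j < i → U i j = 0) :
    U.det = ∏ i, U i i :=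
  Matrix.det_of_upperTriangular fun i j hij => h i j hij

/-- Determinant of a lower triangular matrix on `Fin n`. [folklore] -/
theorem det_eq_prod_diag_of_lower (L : Matrix (Fin n) (Fin n) K) (h : ∀ i j : Fin n, i < j → L i j = 0) :
    L.det = ∏ i, L i i :=
  Matrix.det_of_lowerTriangular L fun i j hij => h i j (OrderDual.toDual_lt_toDual.mp hij)

end Triangular

section RatFacts

variable {n : ℕ}

/-- The Frobenius sum of a rational matrix, read in `ℝ`. [folklore] -/
theorem frobenius_cast (X : Matrix (Fin n) (Fin n) ℚ) :
    ∑ i, ∑ j, (X.map ((↑) : ℚ → ℝ)) i j ^ 2 = ((∑ i, ∑ j, X i j ^ 2 : ℚ) : ℝ) := by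
  push_cast [Matrix.map_apply]
  rfl

/-- `(1 − P Mt)` commutes with the cast `ℚ → ℝ`. [folklore] -/
theorem one_sub_mul_map (P Mt : Matrix (Fin n) (Fin n) ℚ) :
    (1 : Matrix (Fin n) (Fin n) ℝ) - P.map ((↑) : ℚ → ℝ) * Mt.map ((↑) : ℚ → ℝ)
      = ((1 : Matrix (Fin n) (Fin n) ℚ) - P * Mt).map ((↑) : ℚ → ℝ) := by
  have h := map_sub (Rat.castHom ℝ).mapMatrix (1 : Matrix (Fin n) (Fin n) ℚ) (P * Mt)
  rw [map_one, map_mul] at h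
  simpa only [RingHom.mapMatrix_apply, Rat.coe_castHom] using h.symm

/-- `0 < det (P Mt)` over `ℚ` from the kernel Frobenius fact. [folklore] -/
theorem det_P_mul_Mt_pos (P Mt : Matrix (Fin n) (Fin n) ℚ)
    (hfrob : ∑ i, ∑ j, ((1 : Matrix (Fin n) (Fin n) ℚ) - P * Mt) i j ^ 2 < 1) : 0 < (P * Mt).det := by
  have hR : 0 < (P.map ((↑) : ℚ → ℝ) * Mt.map ((↑) : ℚ → ℝ)).det := by
    apply det_mul_pos_of_frobenius_lt_one
    rw [one_sub_mul_map, frobenius_cast]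
    exact_mod_cast hfrob
  have hdet : (P.map ((↑) : ℚ → ℝ) * Mt.map ((↑) : ℚ → ℝ)).det = (((P * Mt).det : ℚ) : ℝ) := by
    rw [← Rat.coe_castHom, ← RingHom.mapMatrix_apply, ← RingHom.mapMatrix_apply, ← map_mul, ← RingHom.map_det]
  rw [hdet] at hR
  exact_mod_cast hR

/-- `det P` for `P = Ui Li`, `Ui` upper triangular, `Li` unit lower triangular. [folklore] -/
theorem det_P_eq (Ui Li P : Matrix (Fin n) (Fin n) ℚ) (hP : Ui * Li = P)
    (hU : ∀ i j : Fin n, j < i → Ui i j = 0) (hL : ∀ i j : Fin n, i < j → Li i j = 0) (hLd : ∀ i, Li i i = 1) :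
    P.det = ∏ i, Ui i i := by
  rw [← hP, Matrix.det_mul, det_eq_prod_diag_of_upper Ui hU, det_eq_prod_diag_of_lower Li hL]
  simp [hLd]

/-- **Sign of `det Mt'`, positive case** (kernel facts in, `0 < det Mt'` out). [folklore] -/
theorem det_pos_of_kernelFacts (Mt Ui Li P : Matrix (Fin n) (Fin n) ℚ) (hP : Ui * Li = P)
    (hfrob : ∑ i, ∑ j, ((1 : Matrix (Fin n) (Fin n) ℚ) - P * Mt) i j ^ 2 < 1)
    (hU : ∀ i j : Fin n, j < i → Ui i j = 0) (hL : ∀ i j : Fin n, i < j → Li i j = 0) (hLd : ∀ i, Li i i = 1)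
    (hsgn : 0 < ∏ i, Ui i i) : 0 < Mt.det := by
  have h := det_P_mul_Mt_pos P Mt hfrob
  rw [Matrix.det_mul, det_P_eq Ui Li P hP hU hL hLd] at h
  exact pos_of_mul_pos_right h hsgn.le

/-- **Sign of `det Mt'`, negative case.** [folklore] -/
theorem det_neg_of_kernelFacts (Mt Ui Li P : Matrix (Fin n) (Fin n) ℚ) (hP : Ui * Li = P)
    (hfrob : ∑ i, ∑ j, ((1 : Matrix (Fin n) (Fin n) ℚ) - P * Mt) i j ^ 2 < 1)
    (hU : ∀ i j : Fin n, j < i → Ui i j = 0) (hL : ∀ i j : Fin n, i < j → Li i j = 0) (hLd : ∀ i, Li i i = 1)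
    (hsgn : ∏ i, Ui i i < 0) : Mt.det < 0 := by
  have h := det_P_mul_Mt_pos P Mt hfrob
  rw [Matrix.det_mul, det_P_eq Ui Li P hP hU hL hLd] at h
  exact neg_of_mul_pos_right h hsgn.le

/-- The real matrix `Mt'ᵀ Mt' − η² 1 − Rᵀ R − μ 1` is the cast of the rational one. [folklore] -/
theorem residual_map (Mt R : Matrix (Fin n) (Fin n) ℚ) (eta mu : ℚ) :
    ((Mt.map ((↑) : ℚ → ℝ))ᵀ * Mt.map ((↑) : ℚ → ℝ) - (eta : ℝ) ^ 2 • (1 : Matrix (Fin n) (Fin n) ℝ)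
        - (R.map ((↑) : ℚ → ℝ))ᵀ * R.map ((↑) : ℚ → ℝ)) - (mu : ℝ) • (1 : Matrix (Fin n) (Fin n) ℝ)
      = ((Mtᵀ * Mt - eta ^ 2 • (1 : Matrix (Fin n) (Fin n) ℚ) - Rᵀ * R) - mu • (1 : Matrix (Fin n) (Fin n) ℚ)).map
          ((↑) : ℚ → ℝ) := by
  ext i j
  simp only [Matrix.sub_apply, Matrix.mul_apply, Matrix.transpose_apply, Matrix.smul_apply, Matrix.one_apply,
    Matrix.map_apply, smul_eq_mul, mul_ite, mul_one, mul_zero]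
  split_ifs <;> push_cast <;> ring

/-- **Test #2 from kernel facts**: `Mt'ᵀ Mt' − η² 1 ≻ 0` (real matrices) from `‖B − μ 1‖_F² < μ²`. [folklore] -/
theorem posDef_of_kernelFacts (Mt R : Matrix (Fin n) (Fin n) ℚ) (eta mu : ℚ) (hmu : 0 < mu)
    (h : ∑ i, ∑ j, ((Mtᵀ * Mt - eta ^ 2 • (1 : Matrix (Fin n) (Fin n) ℚ) - Rᵀ * R)
        - mu • (1 : Matrix (Fin n) (Fin n) ℚ)) i j ^ 2 < mu ^ 2) :
    ((Mt.map ((↑) : ℚ → ℝ))ᵀ * Mt.map ((↑) : ℚ → ℝ) - (eta : ℝ) ^ 2 • (1 : Matrix (Fin n) (Fin n) ℝ)).PosDef := by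
  refine posDef_of_residual _ (R.map ((↑) : ℚ → ℝ)) (c := (mu : ℝ)) (by exact_mod_cast hmu) ?_ ?_
  · simp only [Matrix.transpose_sub, Matrix.transpose_mul, Matrix.transpose_transpose, Matrix.transpose_smul,
      Matrix.transpose_one]
  · rw [residual_map, frobenius_cast]
    exact_mod_cast h

/-- Operator-norm form of the test-#1 residual fact: `‖1 − P Mt'‖₂ ≤ θ`. [folklore] -/
theorem norm_one_sub_P_mul_Mt_le (P Mt : Matrix (Fin n) (Fin n) ℚ) (θ : ℚ) (hθ : 0 ≤ θ)
    (h : ∑ i, ∑ j, ((1 : Matrix (Fin n) (Fin n) ℚ) - P * Mt) i j ^ 2 ≤ θ ^ 2) :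
    ‖(1 : Matrix (Fin n) (Fin n) ℝ) - P.map ((↑) : ℚ → ℝ) * Mt.map ((↑) : ℚ → ℝ)‖ ≤ (θ : ℝ) := by
  refine norm_le_of_frobenius_le _ (by exact_mod_cast hθ) ?_
  rw [one_sub_mul_map, frobenius_cast]
  exact_mod_cast h

/-- Operator-norm form of the `‖P‖_F` fact: `‖P‖₂ ≤ √πsq`. [folklore] -/
theorem norm_P_le (P : Matrix (Fin n) (Fin n) ℚ) (piSq : ℚ) (h : ∑ i, ∑ j, P i j ^ 2 ≤ piSq) :
    ‖P.map ((↑) : ℚ → ℝ)‖ ≤ Real.sqrt piSq := by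
  refine (l2_opNorm_le_sqrt_sum_sq _).trans (Real.sqrt_le_sqrt ?_)
  rw [frobenius_cast]
  exact_mod_cast h

/-- The test-#1 inequality `θ + π η < 1` with `θ = 2^-50`, `π = √πsq`, from `πsq η² < (1 − 2^-50)²`. [folklore] -/
theorem kappa_lt_one (piSq eta : ℚ) (hpi : 0 ≤ piSq) (heta : 0 < eta)
    (h : piSq * eta ^ 2 < (1 - 1 / 2 ^ 50) ^ 2) :
    (1 / 2 ^ 50 : ℝ) + Real.sqrt piSq * (eta : ℝ) < 1 := by
  have h1 : Real.sqrt piSq * (eta : ℝ) = Real.sqrt ((piSq : ℝ) * (eta : ℝ) ^ 2) := by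
    rw [Real.sqrt_mul (by exact_mod_cast hpi), Real.sqrt_sq (by exact_mod_cast heta.le)]
  have h' : ((piSq * eta ^ 2 : ℚ) : ℝ) < (((1 - 1 / 2 ^ 50) ^ 2 : ℚ) : ℝ) := Rat.cast_lt.mpr h
  have e1 : ((piSq * eta ^ 2 : ℚ) : ℝ) = (piSq : ℝ) * (eta : ℝ) ^ 2 := by push_cast; ring
  have e2 : (((1 - 1 / 2 ^ 50) ^ 2 : ℚ) : ℝ) = (1 - 1 / 2 ^ 50 : ℝ) ^ 2 := by push_cast; ring
  rw [e1, e2] at h'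
  have h2 : Real.sqrt ((piSq : ℝ) * (eta : ℝ) ^ 2) < 1 - 1 / 2 ^ 50 := by
    rw [Real.sqrt_lt' (by norm_num)]
    exact h'
  linarith

/-- Positive diagonal matrices have positive determinant (cast form). [folklore] -/
theorem det_diagonal_cast_pos (v : Fin n → ℚ) (hv : ∀ i, 0 < v i) :
    0 < (Matrix.diagonal fun i => (v i : ℝ)).det :=
  det_diagonal_pos _ fun i => by exact_mod_cast hv i

end RatFacts

end Det2pdKernelCert

end Summit.NavierStokesRegularity.JiaSverakCAP

end
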